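import Literature.AlgebraicGeometry.Frobenioids.BiratFrobeniusCompact
import Literature.AlgebraicGeometry.Frobenioids.BiratGerms
import Literature.AlgebraicGeometry.Frobenioids.BirationalizationIsos
import Literature.AlgebraicGeometry.Frobenioids.BirationalizationProp44UnitsProofs
import Literature.AlgebraicGeometry.Frobenioids.ElementaryIsomorphisms
import Literature.AlgebraicGeometry.Frobenioids.UnitTrivializationIsFrobenioid
import HarnessLib

/-!
# Frobenioids I, Def. 4.5 (iii)(b): `(C^un-tr)^birat` admits a Frobenius-compact object as soon as `C` has a
# base-identity pre-step with non-zero divisor over a base with finite-order automorphisms — PROOF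

Mochizuki, *The geometry of Frobenioids I: the general theory*, Kyushu J. Math. **62** (2008) 293–400,
Def. 4.5 (iii)(b) p. 86; proofs of Thm. 6.2 (iii) p. 112 l. 8–15 and Thm. 6.4 (i) p. 115 l. 22–23 ("every
object of `(C^un-tr)^birat` is Frobenius-compact": an automorphism of `A` acts on `Φ^birat(L) ⊗ ℚ` through an
automorphism of `L`, a permutation of prime divisors/places, which cannot rescale a non-zero divisor).
[cite: MochizukiFrdI2008, Def. 4.5 (iii) p.86]

PROOF-ONLY (seat abc-iut-L1-t3 gen 4; layer 2b of the T64i/L10(b) · T62iii/L10 assembly), over abc-iut-L6-t8's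
`Birat`/`BiratFrac`, abc-iut-L6-t6's `biratDivHom`, abc-iut-L1-d1/d5's `C^un-tr` (`toUntr`, `untrFunctor`,
`untrFunctor_faithful`, `isFrobenioid_untr`, `hasBiratSquares_untr`, `isCoAngularPreStep_toUntr_of`):
* `Birat.biratDivHom_injective_of_faithful` — if the structure functor `C → F_Φ` is FAITHFUL (e.g. `C^un-tr → F_Φ`,
  Prop. 3.3 (ii)), a unit of `A^birat` is determined by its divisor (two fractions with the same divisor, brought
  to a common denominator by Def. 1.3 (iii)(d), have numerators with the same image in `F_Φ`);
* `Birat.isoOfPreStep_mem_unitsSubgroup` / `biratDivHom_isoOfPreStep` — a base-identity pre-step `α : A → A`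
  (an element of `O^▷(A)`) becomes a unit of `A^birat` with divisor `Div(α)`; more generally a PAIR of
  base-equivalent co-angular pre-steps `(α, φ) : A' ⇉ A` (abc-iut-L6-t6's `RatFrac`, "a rational function") is a
  unit `φ ∘ α⁻¹` (abc-iut-w4-d020's `BiratUnits.toAut`) with divisor `≠ 0` iff `Div α ≠ Div φ`
  (`Birat.isFrobeniusCompact_of_ratFrac`);
* **`Birat.untr_isFrobeniusCompact_of_preSteps`** — for a Frobenioid `C`, isotropic objects `A, A'` and two
  pre-steps `α, φ : A' → A` with the same base and different divisors, over a base object whose automorphisms act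
  on `Φ^gp` with finite order and whose `Φ^gp` has no torsion: `(A^un-tr)^birat ∈ (C^un-tr)^birat` is
  Frobenius-compact; `Birat.exists_isFrobeniusCompact_untrBirat_of_preSteps` — hence Def. 4.5 (iii)(b) for `C`
  at THE `(C^un-tr)^birat` of abc-iut's `PreFrobenioid.rsParams`.
No definitions; nothing here bears on [IUTchIII] or asserts anything about abc.
-/

namespace Literature.AlgebraicGeometry.Frobenioids

open CategoryTheory Opposite

universe w v v' u u'

namespace PreFrobenioid

variable {D : Type u} [Category.{v} D] {Φ : Dᵒᵖ ⥤ CommMonCat.{w}}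
  {C : Type u'} [Category.{v'} C] {F : C ⥤ ElemFrobenioid Φ} {hF : IsFrobenioid F} {hsq : HasBiratSquares F}

namespace Birat

open PreFrobenioidData (ofFunctor)

/-! ### Units of `A^birat` are determined by their divisors when `C → F_Φ` is faithful -/

/-- **A unit of `A^birat` is determined by its divisor** when the structure functor `C → F_Φ` is faithful
(as for `C^un-tr`, Prop. 3.3 (ii)/(iv)): write both units as fractions `(α, φ')` with a COMMON co-angular
pre-step denominator `α` (Def. 1.3 (iii)(d), `exists_common_refinement`); their numerators are pre-steps with the
same base as `α` (Prop. 4.4 (iii)) and — the divisors being equal — the same zero divisor, hence the same image in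
`F_Φ`, hence are equal. [cite: MochizukiFrdI2008, Prop. 4.4 (iii) p.84] -/
theorem biratDivHom_injective_of_faithful [F.Faithful] (A : C) :
    Function.Injective (biratDivHom hF hsq A) := by
  intro u v h
  obtain ⟨fu, hfu⟩ := homMk_surjective u.1.hom
  obtain ⟨fv, hfv⟩ := homMk_surjective v.1.hom
  obtain ⟨hnu, hbu⟩ := isPreStep_num_of_mem_unitsSubgroup u fu hfu
  obtain ⟨hnv, hbv⟩ := isPreStep_num_of_mem_unitsSubgroup v fv hfv
  obtain ⟨T, κ, κ', hκ, hκ', hT⟩ := exists_common_refinement hF fu.den fv.den fu.den_mem fv.den_mem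
  have hdmem : IsCoAngularPreStep F (κ ≫ fu.den) := hκ.comp hF fu.den_mem
  -- the two fractions over the common denominator `κ ≫ fu.den = κ' ≫ fv.den`
  let fu' : BiratFrac F A A := ⟨T, κ ≫ fu.den, κ ≫ fu.num, hdmem⟩
  let fv' : BiratFrac F A A := ⟨T, κ ≫ fu.den, κ' ≫ fv.num, hdmem⟩
  have hrelu : BiratFrac.Rel fu' fu := BiratFrac.rel_restrict hF fu κ hκ
  have hrelv : BiratFrac.Rel fv' fv := by
    have key : ∀ {d₁ d₂ : T ⟶ A} (h₁ : IsCoAngularPreStep F d₁) (h₂ : IsCoAngularPreStep F d₂), d₁ = d₂ →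
        (⟨T, d₁, κ' ≫ fv.num, h₁⟩ : BiratFrac F A A) = ⟨T, d₂, κ' ≫ fv.num, h₂⟩ := by
      intro d₁ d₂ h₁ h₂ e; subst e; rfl
    have e : fv' = ⟨T, κ' ≫ fv.den, κ' ≫ fv.num, hκ'.comp hF fv.den_mem⟩ := key _ _ hT
    rw [e]
    exact BiratFrac.rel_restrict hF fv κ' hκ'
  -- equal divisors
  have hdiv' : BiratFrac.divGp fu' = BiratFrac.divGp fv' := by
    rw [BiratFrac.divGp_rel hF hrelu, BiratFrac.divGp_rel hF hrelv, ← biratDivHom_apply_of_eq u fu hfu,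
      ← biratDivHom_apply_of_eq v fv hfv, h]
  -- degrees of the numerators
  have hdegu : degFr F (κ ≫ fu.num) = 1 := by rw [degFr_comp, hκ.2.1, one_mul]; exact hnu.1
  have hdegv : degFr F (κ' ≫ fv.num) = 1 := by rw [degFr_comp, hκ'.2.1, one_mul]; exact hnv.1
  -- the zero divisors of the numerators agree
  haveI : IsIso (Base F (κ ≫ fu.den)) := hdmem.2.2
  haveI : IsCancelMul (Φ.obj (op (baseObj F T))) :=
    isIntegral_iff_isCancelMul.mp (hF.isPreFrobenioid.isDivisorial _).isPreDivisorial.isIntegral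
  have hDiv : Div F (κ ≫ fu.num) = Div F (κ' ≫ fv.num) := by
    have h1 : pullGp Φ (inv (Base F (κ ≫ fu.den)))
        (Algebra.GrothendieckGroup.of (Div F (κ ≫ fu.num)) /
          Algebra.GrothendieckGroup.of (Div F (κ ≫ fu.den)) ^ ((BiratFrac.deg fu' : ℕ+) : ℕ)) =
        pullGp Φ (inv (Base F (κ ≫ fu.den)))
        (Algebra.GrothendieckGroup.of (Div F (κ' ≫ fv.num)) /
          Algebra.GrothendieckGroup.of (Div F (κ ≫ fu.den)) ^ ((BiratFrac.deg fv' : ℕ+) : ℕ)) := hdiv'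
    rw [show BiratFrac.deg fu' = 1 from hdegu, show BiratFrac.deg fv' = 1 from hdegv] at h1
    have h2 := pullGp_injective (inv (Base F (κ ≫ fu.den))) h1
    exact (hF.isPreFrobenioid.isDivisorial _).isPreDivisorial.isIntegral.injective_of (div_left_injective h2)
  -- the bases of the numerators agree
  have hbu' : Base F fu.num = Base F fu.den := hbu.symm
  have hbv' : Base F fv.num = Base F fv.den := hbv.symm
  have hBase : Base F (κ ≫ fu.num) = Base F (κ' ≫ fv.num) := by
    rw [base_comp, hbu', ← base_comp, hT, base_comp, ← hbv', ← base_comp]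
  -- hence the numerators agree in `F_Φ`, hence in `C`
  have hmap : F.map (κ ≫ fu.num) = F.map (κ' ≫ fv.num) :=
    ElemFrobenioid.Hom.ext hBase hDiv (hdegu.trans hdegv.symm)
  have hnum : κ ≫ fu.num = κ' ≫ fv.num := F.map_injective hmap
  have hfrac : fu' = fv' := congrArg (fun n => (⟨T, κ ≫ fu.den, n, hdmem⟩ : BiratFrac F A A)) hnum
  have hrelv' : BiratFrac.Rel fu' fv := by rw [hfrac]; exact hrelv
  apply Subtype.ext
  apply Iso.ext
  rw [← hfu, ← hfv]
  exact homMk_sound (hrelu.symm.trans hF hrelv')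

/-! ### Units of `A^birat` from base-identity pre-steps of `A` -/

/-- A co-angular pre-step `α : A → A` with `Base(α) = id` (an element of `O^▷(A)`) becomes invertible in
`C^birat` (Prop. 4.4 (iv)) and its image is a UNIT of `A^birat` (base-identity, linear).
[cite: MochizukiFrdI2008, Prop. 4.4 (iv) p.83] -/
theorem isoOfPreStep_mem_unitsSubgroup {A : C} (α : A ⟶ A) (hα : IsCoAngularPreStep F α)
    (hbase : Base F α = 𝟙 _) :
    @asIso _ _ _ _ ((toBirat F hF hsq).map α) (isIso_toBirat_map α hα) ∈
      (biratOps hF hsq).unitsSubgroup ((toBirat F hF hsq).obj A) := by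
  refine ⟨?_, ?_⟩
  · change (biratOps hF hsq).base.map ((toBirat F hF hsq).map α) = 𝟙 _
    rw [biratOps_base_map_toBirat]; exact hbase
  · change (biratOps hF hsq).degFr ((toBirat F hF hsq).map α) = 1
    rw [biratOps_degFr_toBirat]; exact hα.2.1

/-- The divisor of that unit is `Div(α) ∈ Φ(Base A) ⊆ Φ^gp(Base A)`. [cite: MochizukiFrdI2008, Prop. 4.4 (iii) p.84] -/
theorem biratDivHom_isoOfPreStep {A : C} (α : A ⟶ A) (hα : IsCoAngularPreStep F α) (hbase : Base F α = 𝟙 _) :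
    biratDivHom hF hsq A ⟨_, isoOfPreStep_mem_unitsSubgroup α hα hbase⟩ =
      Algebra.GrothendieckGroup.of (Div F α) := by
  change ElemFrobenioid.Div ((toBirat F hF hsq ⋙ toElemGp hF hsq).map α) = _
  rw [toBirat_comp_toElemGp_map]
  rfl

/-- **`A^birat` is Frobenius-compact from one rational function with non-zero divisor**: `C → F_Φ` faithful,
a pair of base-equivalent co-angular pre-steps `(α, φ) : A' ⇉ A` with `Div α ≠ Div φ` (its class `φ ∘ α⁻¹` is a
unit of `A^birat` with non-trivial divisor, Prop. 4.4 (iv)), `Φ^gp(Base A)` without torsion and every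
automorphism of `Base A` acting on it with finite order. [cite: MochizukiFrdI2008, Def. 4.5 (iii) p.86] -/
theorem isFrobeniusCompact_of_ratFrac [F.Faithful] {A : C} (p : RatFrac F A) (hne : Div F p.den ≠ Div F p.num)
    (htf : ∀ (x : Algebra.GrothendieckGroup (Φ.obj (op (baseObj F A)))) (n : ℕ), 0 < n → x ^ n = 1 → x = 1)
    (hfin : ∀ g : baseObj F A ⟶ baseObj F A, IsIso g →
      ∃ n : ℕ, 0 < n ∧ ∀ x, (pull (monoidGp Φ) g)^[n] x = x) :
    (biratOps hF hsq).IsFrobeniusCompact ((toBirat F hF hsq).obj A) := by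
  haveI : IsCancelMul (Φ.obj (op (baseObj F A))) :=
    isIntegral_iff_isCancelMul.mp (hF.isPreFrobenioid.isDivisorial _).isPreDivisorial.isIntegral
  refine isFrobeniusCompact_of_unit A htf hfin (biratDivHom_injective_of_faithful A) _
    (toAut_mem_unitsSubgroup (hsq := hsq) (BiratUnits.mk hF p)) ?_
  rw [biratDivHom_toAut, BiratUnits.divHom_mk]
  -- `div p = (φ^*)⁻¹ Div φ / (α^*)⁻¹ Div α ≠ 1` since `α^* = φ^*` is injective and `Div α ≠ Div φ`
  haveI : IsIso (Base F p.den) := p.den_mem.2.2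
  haveI : IsIso (Base F p.num) := p.num_mem.2.2
  have hinv : inv (Base F p.num) = inv (Base F p.den) :=
    IsIso.inv_eq_of_hom_inv_id (by
      rw [show Base F p.num = Base F p.den from p.baseEq.symm]
      exact IsIso.hom_inv_id _)
  intro h
  apply hne
  have h1 : Algebra.GrothendieckGroup.of (invDiv F p.num p.num_mem.2.2) =
      Algebra.GrothendieckGroup.of (invDiv F p.den p.den_mem.2.2) := div_eq_one.mp h
  have h2 := (hF.isPreFrobenioid.isDivisorial _).isPreDivisorial.isIntegral.injective_of h1
  change pull Φ (inv (Base F p.num)) (Div F p.num) = pull Φ (inv (Base F p.den)) (Div F p.den) at h2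
  rw [hinv] at h2
  exact (pull_injective_of_isIso Φ (inv (Base F p.den)) h2).symm

/-! ### `(C^un-tr)^birat` -/

/-- **`(A^un-tr)^birat ∈ (C^un-tr)^birat` is Frobenius-compact** for a Frobenioid `C → F_Φ`, isotropic objects
`A, A'` and two pre-steps `α, φ : A' → A` with `Base α = Base φ`, `Div α ≠ Div φ` (a rational function with
non-zero divisor), over a base object `Base A` whose `Φ^gp` has no torsion and whose automorphisms act on `Φ^gp`
with finite order (the structure functor `C^un-tr → F_Φ` being faithful, Prop. 3.3 (ii), and the classes of
`α, φ` co-angular pre-steps of `C^un-tr`, Prop. 3.3 (iv)). [cite: MochizukiFrdI2008, Def. 4.5 (iii) p.86] -/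
theorem untr_isFrobeniusCompact_of_preSteps (hF : IsFrobenioid F) (A A' : (ofFunctor Φ F).Istr)
    (α φ : A' ⟶ A) (hα : IsPreStep F α.hom) (hφ : IsPreStep F φ.hom) (hbase : Base F α.hom = Base F φ.hom)
    (hne : Div F α.hom ≠ Div F φ.hom)
    (htf : ∀ (x : Algebra.GrothendieckGroup (Φ.obj (op (baseObj F A.obj)))) (n : ℕ), 0 < n → x ^ n = 1 → x = 1)
    (hfin : ∀ g : baseObj F A.obj ⟶ baseObj F A.obj, IsIso g →
      ∃ n : ℕ, 0 < n ∧ ∀ x, (pull (monoidGp Φ) g)^[n] x = x) :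
    (biratOps (isFrobenioid_untr hF) (hasBiratSquares_untr hF)).IsFrobeniusCompact
      ((toBirat (untrFunctor hF) (isFrobenioid_untr hF) (hasBiratSquares_untr hF)).obj
        ((ofFunctor Φ F).toUntr.obj A)) := by
  haveI := untrFunctor_faithful hF
  let p : RatFrac (untrFunctor hF) ((ofFunctor Φ F).toUntr.obj A) :=
    ⟨(ofFunctor Φ F).toUntr.obj A', (ofFunctor Φ F).toUntr.map α, (ofFunctor Φ F).toUntr.map φ,
      isCoAngularPreStep_toUntr_of hF α hα, isCoAngularPreStep_toUntr_of hF φ hφ, hbase⟩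
  exact isFrobeniusCompact_of_ratFrac (hF := isFrobenioid_untr hF) (hsq := hasBiratSquares_untr hF) p hne htf
    hfin

/-- **Def. 4.5 (iii)(b) for `C`**: under the hypotheses of `untr_isFrobeniusCompact_of_preSteps`, THE
`(C^un-tr)^birat` (= the `BU` of abc-iut's `PreFrobenioid.rsParams`) admits a Frobenius-compact object.
[cite: MochizukiFrdI2008, Def. 4.5 (iii) p.86] -/
theorem exists_isFrobeniusCompact_untrBirat_of_preSteps (hF : IsFrobenioid F) (A A' : (ofFunctor Φ F).Istr)
    (α φ : A' ⟶ A) (hα : IsPreStep F α.hom) (hφ : IsPreStep F φ.hom) (hbase : Base F α.hom = Base F φ.hom)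
    (hne : Div F α.hom ≠ Div F φ.hom)
    (htf : ∀ (x : Algebra.GrothendieckGroup (Φ.obj (op (baseObj F A.obj)))) (n : ℕ), 0 < n → x ^ n = 1 → x = 1)
    (hfin : ∀ g : baseObj F A.obj ⟶ baseObj F A.obj, IsIso g →
      ∃ n : ℕ, 0 < n ∧ ∀ x, (pull (monoidGp Φ) g)^[n] x = x) :
    ∃ Y : (biratData (isFrobenioid_untr hF) (hasBiratSquares_untr hF)).Birat,
      (biratData (isFrobenioid_untr hF) (hasBiratSquares_untr hF)).ops.IsFrobeniusCompact Y :=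
  ⟨_, untr_isFrobeniusCompact_of_preSteps hF A A' α φ hα hφ hbase hne htf hfin⟩

end Birat

end PreFrobenioid

end Literature.AlgebraicGeometry.Frobenioids
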